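import Summits.ResolutionOfSingularities.ResolutionOfSingularities.Theorems.FrobeniusLadderFRationalResolutionFixedPointAdjoin
import Summits.ResolutionOfSingularities.ResolutionOfSingularities.Theorems.FrobeniusLadderFRationalResolutionGradedMonomials
import Literature.RingTheory.GradedAlgebra.LocalizationDegreeZero
import Mathlib.Algebra.Group.Submonoid.Operations
import HarnessLib

/-!
# Crux `FrobeniusLadder.FRationalResolution` (stmt-ResolutionOfSingularities-15317), line `redirect`,
# stub `stub_diagonalizableQuotientResolution` — at a `D(A)`-fixed point the ideal `𝔮 = 𝔔 ∩ S₀` of the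
# quotient chart is LOCALLY GENERATED BY DEGREE-ZERO MONOMIALS in a homogeneous system of generators
# of `𝔔 S_𝔔` (Kato's condition (2.1)(i) for the monomial chart; linearisation step L3, brick 6)

Assembly of bricks 1–5 (`…FixedPointGenerators`, `…AdjoinParameters`, `…FixedPointLocal`,
`…GradedMonomials`, `…FixedPointAdjoin`) with the graded localization
`Literature.RingTheory.GradedAlgebra.locPiece`: for `S` Noetherian of finite type over a field, graded
by a torsion group, a prime `𝔔 ⊇ S_a` (`a ≠ 0`) and a finite set `t ⊆ 𝔔` of HOMOGENEOUS elements whose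
image generates the maximal ideal of `S_𝔔`,

* `exists_mul_mem_span_monomials_of_fixed` — **every `r ∈ 𝔮 = 𝔔 ∩ S₀` satisfies `u r ∈ (G)` for some
  `u ∈ S₀ ∖ 𝔮`, where `G = {g ∈ S₀ ∩ 𝔔 : g a monomial in t}`**; equivalently
* `maximalIdeal_eq_span_monomials_of_fixed` — for every localization `Rq` of `S₀` at `𝔮`,
  `𝔪_{Rq} = (image of G)`.

For the chart `M = {m : Σ mᵢ deg tᵢ = 0} → S₀`, `m ↦ t^m`, `G ⊆ φ(M ∖ F_𝔮) ⊆ 𝔮`, so Kato's ideal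
satisfies `I(𝔮) Rq = 𝔪_{Rq}` and `Rq / I(𝔮) Rq = κ(𝔮)` is regular — condition (2.1)(i) of Kato's
log-regularity at a fixed point. Honest label: brick of L3 (no stub closed; the dimension half
(2.1)(ii) and the `LogChart` packaging remain). No definitions, no named facts, no sorry.
[folklore; cite: Kato1994, Def. (2.1)] [cite: SGA3, Exp. VIII §4–5]
-/

noncomputable section

-- single-problem summit: the doubled namespace component is forced
set_option linter.dupNamespace false

open DirectSum IsLocalRing
open Literature.AlgebraicGeometry.Resolution.DiagonalizableQuotient
open Literature.RingTheory.GradedAlgebra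

namespace Summit.ResolutionOfSingularities.ResolutionOfSingularities.Theorems.FRationalResolution.FixedPointKatoIdeal

universe u w

variable {k : Type u} [Field k] {A : Type w} [DecidableEq A] [AddCommGroup A] {S : Type u}
  [CommRing S] [Algebra k S] (𝒮 : A → Submodule k S) [GradedAlgebra 𝒮]

/-- Transport of the generation statement `span (image of t) = 𝔪` between localizations at `𝔔`.
[folklore] -/
theorem span_image_eq_maximalIdeal_of_atPrime (𝔔 : Ideal S) [𝔔.IsPrime] (t : Finset S)
    (htspan : Ideal.span (algebraMap S (Localization.AtPrime 𝔔) '' (↑t : Set S)) =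
      maximalIdeal (Localization.AtPrime 𝔔))
    (L : Type u) [CommRing L] [Algebra S L] [IsLocalization.AtPrime L 𝔔] [IsLocalRing L] :
    Ideal.span (algebraMap S L '' (↑t : Set S)) = maximalIdeal L := by
  let e : Localization.AtPrime 𝔔 ≃ₐ[S] L := IsLocalization.algEquiv 𝔔.primeCompl _ L
  have hcomp : (e : Localization.AtPrime 𝔔 →+* L).comp (algebraMap S (Localization.AtPrime 𝔔)) =
      algebraMap S L := RingHom.ext fun s => e.commutes s
  have h1 : Ideal.span (algebraMap S L '' (↑t : Set S)) = (Ideal.span (↑t : Set S)).map (algebraMap S L) := by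
    rw [Ideal.map_span]
  have h2 : Ideal.span (algebraMap S (Localization.AtPrime 𝔔) '' (↑t : Set S)) =
      (Ideal.span (↑t : Set S)).map (algebraMap S (Localization.AtPrime 𝔔)) := by
    rw [Ideal.map_span]
  rw [h1, ← hcomp, ← Ideal.map_map, ← h2, htspan, ← Localization.AtPrime.map_eq_maximalIdeal,
    Ideal.map_map, hcomp, IsLocalization.AtPrime.map_eq_maximalIdeal 𝔔 L]

/-- **Kato (2.1)(i) at a fixed point, localization-free form.** `S` Noetherian of finite type over a
field, torsion grading, `𝔔 ⊇ S_a` (`a ≠ 0`), `t ⊆ 𝔔` finite, homogeneous, generating `𝔪_{S_𝔔}`. Then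
every `r ∈ 𝔮 = 𝔔 ∩ S₀` is, after multiplication by some `u ∈ S₀ ∖ 𝔮`, an `S₀`-combination of the
MONOMIALS in `t` lying in `S₀ ∩ 𝔔`. (In `L = S_𝔔 = (S₀)_𝔮[t]`, `r ∈ 𝔔L ∩ L₀` is an `L₀`-combination of
degree-`0` monomials in `𝔔L` by `GradedMonomials.mem_span_monomials_of_mem_span_range`; a degree-`0`
monomial is the image of a monomial of `S` of degree `0`, or zero.) [folklore; cite: Kato1994, Def. (2.1)] -/
theorem exists_mul_mem_span_monomials_of_fixed [IsNoetherianRing S] [Algebra.FiniteType k S]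
    (hA : AddMonoid.IsTorsion A) (𝔔 : Ideal S) [𝔔.IsPrime]
    (hfix : ∀ a : A, a ≠ 0 → ∀ s ∈ 𝒮 a, s ∈ 𝔔) (t : Finset S)
    (hthom : ∀ s ∈ t, SetLike.IsHomogeneousElem 𝒮 s)
    (htspan : Ideal.span (algebraMap S (Localization.AtPrime 𝔔) '' (↑t : Set S)) =
      maximalIdeal (Localization.AtPrime 𝔔))
    (r : 𝒮 0) (hr : (r : S) ∈ 𝔔) :
    ∃ u : 𝒮 0, (u : S) ∉ 𝔔 ∧ u * r ∈ Ideal.span {g : 𝒮 0 | (g : S) ∈ 𝔔 ∧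
      (g : S) ∈ Submonoid.closure (↑t : Set S)} := by
  classical
  set 𝔮 : Ideal (𝒮 0) := 𝔔.comap (algebraMap (𝒮 0) S) with h𝔮
  set T : Submonoid S := 𝔮.primeCompl.map (algebraMap (𝒮 0) S) with hTdef
  have hT : ∀ s ∈ T, s ∈ 𝒮 0 := by
    rintro _ ⟨u, -, rfl⟩
    exact u.2
  let L := Localization T
  -- `L` is local, `= S_𝔔`
  haveI : IsLocalRing L := FixedPointLocal.isLocalRing_localization_of_fixed 𝒮 hA 𝔔 hfix L
  haveI : IsLocalization.AtPrime L 𝔔 :=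
    FixedPointLocal.isLocalization_atPrime_of_fixed 𝒮 hA 𝔔 hfix L
  -- the grading on `L`
  let ℒ := locPiece 𝒮 T hT L
  letI : GradedAlgebra ℒ := (nonempty_gradedAlgebra_locPiece 𝒮 T hT L).some
  letI := locPieceZeroAlgebra 𝒮 T hT L
  have hloc := isLocalization_locPiece_zero 𝒮 T hT L
  rw [Submonoid.comap_map_eq_of_injective (algebraMap_gradeZero_injective 𝒮)] at hloc
  haveI : IsLocalization.AtPrime (ℒ 0) 𝔮 := hloc
  haveI : IsScalarTower (𝒮 0) (ℒ 0) L := IsScalarTower.of_algebraMap_eq fun a => rfl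
  -- the generators in `L`, homogeneous
  let x : Fin t.card → L := fun i => algebraMap S L (t.equivFin.symm i)
  have hrange : Set.range x = algebraMap S L '' (↑t : Set S) := by
    ext y
    constructor
    · rintro ⟨i, rfl⟩
      exact ⟨_, (t.equivFin.symm i).2, rfl⟩
    · rintro ⟨s, hs, rfl⟩
      exact ⟨t.equivFin ⟨s, hs⟩, by simp [x]⟩
  choose deg hdeg using fun i : Fin t.card => hthom _ (t.equivFin.symm i).2
  have hx : ∀ i, x i ∈ ℒ (deg i) := fun i => algebraMap_mem_locPiece hT (hdeg i)
  -- `L = L₀[x]`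
  have hspanL : Ideal.span (algebraMap S L '' (↑t : Set S)) = maximalIdeal L :=
    span_image_eq_maximalIdeal_of_atPrime 𝔔 t htspan L
  have hgen : Algebra.adjoin (ℒ 0) (Set.range x) = ⊤ := by
    rw [hrange]
    exact FixedPointAdjoin.adjoin_eq_top_atPrime_of_fixed 𝒮 hA 𝔔 hfix (ℒ 0) L t hspanL
  -- `r ∈ 𝔔 L ∩ L₀` is a combination of degree-`0` monomials in `𝔔 L`
  have hrL : algebraMap S L r ∈ Ideal.span (Set.range x) := by
    rw [hrange, hspanL]
    exact (IsLocalization.AtPrime.to_map_mem_maximal_iff L 𝔔 _).mpr hr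
  have hr0 : algebraMap S L r ∈ ℒ 0 := algebraMap_mem_locPiece hT r.2
  have key := GradedMonomials.mem_span_monomials_of_mem_span_range ℒ x deg hx hgen _ hr0 hrL
  -- each such monomial is (the image of) an element of `G`, or we do not care: it lies in the
  -- `L₀`-span of the image of `G`
  set G : Set (𝒮 0) := {g : 𝒮 0 | (g : S) ∈ 𝔔 ∧ (g : S) ∈ Submonoid.closure (↑t : Set S)} with hG
  have hsub : {μ : L | μ ∈ Submonoid.closure (Set.range x) ∧ μ ∈ ℒ 0 ∧ μ ∈ Ideal.span (Set.range x)}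
      ⊆ (Submodule.span (ℒ 0) ((fun g : 𝒮 0 => algebraMap S L g) '' G) : Set L) := by
    rintro μ ⟨hμ, hμ0, hμJ⟩
    -- `μ` is the image of a monomial `m₀` of `S`
    rw [hrange, ← MonoidHom.map_mclosure] at hμ
    obtain ⟨m₀, hm₀, rfl⟩ := Submonoid.mem_map.mp hμ
    -- `m₀` is homogeneous of some degree `d`
    have hm₀hom : SetLike.IsHomogeneousElem 𝒮 m₀ := by
      have hle : Submonoid.closure (↑t : Set S) ≤ SetLike.homogeneousSubmonoid 𝒮 :=
        Submonoid.closure_le.mpr fun s hs => hthom s hs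
      exact hle hm₀
    obtain ⟨d, hd⟩ := hm₀hom
    by_cases hd0 : d = 0
    · subst hd0
      refine Submodule.subset_span ⟨⟨m₀, hd⟩, ⟨?_, hm₀⟩, rfl⟩
      rw [hrange, hspanL] at hμJ
      exact (IsLocalization.AtPrime.to_map_mem_maximal_iff L 𝔔 m₀).mp hμJ
    · -- wrong degree: the image is `0`
      have hμd : algebraMap S L m₀ ∈ ℒ d := algebraMap_mem_locPiece hT hd
      have hzero : algebraMap S L m₀ = 0 := by
        have h := decompose_of_mem_ne ℒ hμd hd0
        rw [decompose_of_mem_same ℒ hμ0] at h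
        exact h
      rw [hzero]
      exact Submodule.zero_mem _
  have key' : algebraMap S L r ∈ Submodule.span (ℒ 0) ((fun g : 𝒮 0 => algebraMap S L g) '' G) :=
    (Submodule.span_le.mpr hsub) key
  -- back to an ideal of `L₀`, then to `S₀`
  set φ := algebraMap (𝒮 0) (ℒ 0) with hφ
  have hmap : Submodule.map (Algebra.linearMap (ℒ 0) L) (Ideal.span (φ '' G)) =
      Submodule.span (ℒ 0) ((fun g : 𝒮 0 => algebraMap S L g) '' G) := by
    rw [Submodule.map_span, Set.image_image]
    rfl
  rw [← hmap] at key'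
  obtain ⟨y, hy, hyr⟩ := key'
  have hyφ : y = φ r := by
    apply Subtype.val_injective
    exact hyr
  rw [hyφ, ← Ideal.map_span] at hy
  obtain ⟨m, hm, hmr⟩ :=
    (IsLocalization.algebraMap_mem_map_algebraMap_iff 𝔮.primeCompl (ℒ 0) (Ideal.span G) r).mp hy
  exact ⟨m, hm, hmr⟩

/-- **Kato (2.1)(i) at a fixed point, for any localization of `S₀` at `𝔮 = 𝔔 ∩ S₀`:** the maximal
ideal of `Rq = (S₀)_𝔮` is generated by the images of the degree-`0` monomials in `t` lying in `𝔔`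
(same hypotheses as `exists_mul_mem_span_monomials_of_fixed`). [folklore; cite: Kato1994, Def. (2.1)] -/
theorem maximalIdeal_eq_span_monomials_of_fixed [IsNoetherianRing S] [Algebra.FiniteType k S]
    (hA : AddMonoid.IsTorsion A) (𝔔 : Ideal S) [𝔔.IsPrime]
    (hfix : ∀ a : A, a ≠ 0 → ∀ s ∈ 𝒮 a, s ∈ 𝔔) (t : Finset S)
    (hthom : ∀ s ∈ t, SetLike.IsHomogeneousElem 𝒮 s)
    (htspan : Ideal.span (algebraMap S (Localization.AtPrime 𝔔) '' (↑t : Set S)) =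
      maximalIdeal (Localization.AtPrime 𝔔))
    (Rq : Type u) [CommRing Rq] [Algebra (𝒮 0) Rq]
    [IsLocalization.AtPrime Rq (𝔔.comap (algebraMap (𝒮 0) S))] [IsLocalRing Rq] :
    maximalIdeal Rq = Ideal.span (algebraMap (𝒮 0) Rq '' {g : 𝒮 0 | (g : S) ∈ 𝔔 ∧
      (g : S) ∈ Submonoid.closure (↑t : Set S)}) := by
  set 𝔮 : Ideal (𝒮 0) := 𝔔.comap (algebraMap (𝒮 0) S) with h𝔮
  apply le_antisymm
  · intro z hz
    obtain ⟨r, ⟨u, hu⟩, rfl⟩ := IsLocalization.exists_mk'_eq 𝔮.primeCompl z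
    have hr : (r : S) ∈ 𝔔 := by
      have h := (IsLocalization.AtPrime.mk'_mem_maximal_iff Rq 𝔮 r ⟨u, hu⟩).mp hz
      exact h
    obtain ⟨v, hv, hvr⟩ := exists_mul_mem_span_monomials_of_fixed 𝒮 hA 𝔔 hfix t hthom htspan r hr
    have hv' : v ∈ 𝔮.primeCompl := hv
    -- `r/u = (v r)/(v u) = (v r) · 1/(v u)`
    have hmk : IsLocalization.mk' Rq r ⟨u, hu⟩ =
        algebraMap (𝒮 0) Rq (v * r) *
          IsLocalization.mk' Rq (1 : 𝒮 0) ⟨v * u, 𝔮.primeCompl.mul_mem hv' hu⟩ := by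
      rw [← IsLocalization.mk'_eq_mul_mk'_one]
      exact IsLocalization.mk'_eq_of_eq (by simp only; ring)
    rw [hmk, ← Ideal.map_span]
    exact Ideal.mul_mem_right _ _ (Ideal.mem_map_of_mem _ hvr)
  · rw [← Ideal.map_span, ← IsLocalization.AtPrime.map_eq_maximalIdeal 𝔮 Rq]
    refine Ideal.map_mono (Ideal.span_le.mpr ?_)
    rintro g ⟨hg, -⟩
    exact hg

end Summit.ResolutionOfSingularities.ResolutionOfSingularities.Theorems.FRationalResolution.FixedPointKatoIdeal

end
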